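import Summits.BirchSwinnertonDyer.BirchSwinnertonDyer.Theorems.ThetaPartnerAtTwoSignedKatoUpToAtTwoCoreOfFiniteErl
import Summits.BirchSwinnertonDyer.BirchSwinnertonDyer.Theorems.ThetaPartnerAtTwoSignedKatoUpToAtTwoLocalTwoPlusColemanKernel
import Literature.NumberTheory.EllipticCurves.PAdicPowerSeriesZeros
import Literature.NumberTheory.EllipticCurves.PAdicLFunctionProofs
import Literature.NumberTheory.EllipticCurves.PAdicBSDMemIwasawaRatProofs
import Literature.NumberTheory.EllipticCurves.PlusMinusPAdicLFunction
import Literature.NumberTheory.EllipticCurves.PAdicPowerSeriesInterpolationAgreementProofs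
import HarnessLib

/-!
# Route `ThetaPartnerAtTwo` (TP2), crux K3 `SignedKatoDivisibilityUpToAtTwo` (item stmt-BirchSwinnertonDyer-20308) /
# K3P′ (stmt-BirchSwinnertonDyer-25631), line `colemanrat` v11 — `Λ`-ALGEBRA for the character-value socket CORE_χ:
# «values at the `ζ − 1`, `ζ^{pⁿ} = 1` ⟺ congruence modulo `ω_n`» and «the characters of `G_n` exhaust `μ_{2ⁿ}`»

Width seat `bsd-wall-tp2-p2x-w3` g6 (cell `bsd-wall`). HONEST FRAMING: theorems only (no definition, no named fact, no
instance, no `sorry`); pure algebra of `Λ = ℤ_p⟦T⟧` and of Dirichlet characters; nothing about any curve; closes no item;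
K3 / K3P′ are NOT settled and BSD is NOT proved by any of this. Consumed by the sequel `…CoreOfCharValues.lean`
(`CoreChi.core_fin_of_coreChi : CORE_χ → CORE_fin`, the registered PUB stub `stub_katoFiniteErlTwo` re-socketed in Kato's
character-value currency).

## What is here

* §1 (any prime `p`) **`toIwasawa_cyclotomicOmega_dvd_of_forall_eval_eq_zero`**: `H ∈ Λ` with `H(ζ − 1) = ∑_k ι(H_k)(ζ−1)^k = 0`
  in `ℂ_p` for every `ζ ∈ ℂ_p`, `ζ^{pⁿ} = 1` ⟹ `ω_n ∣ H` in `Λ`, `ω_n = (1+T)^{pⁿ} − 1` — Weierstrass division by the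
  distinguished polynomial `ω_n` (Washington Prop. 7.2; Mathlib `PowerSeries.eq_mul_weierstrassDiv_add_weierstrassMod`,
  `ω_n ≡ T^{pⁿ} (mod p)` = `LocalTwo.order_map_mk_toIwasawa_cyclotomicOmega`) leaves a remainder of degree `< pⁿ` vanishing at the
  `pⁿ` distinct points `ζ − 1`, hence `0`. This is the CONVERSE of the tree's `IsCongrModOmega.eval₂_eq`; it was not in the tree.
  **`exists_C_pow_mul_sub_eq_omega_mul_of_forall_eval`**: for `θ ∈ ℚ[T]`, `A, B ∈ Λ`, «`A(ζ−1)·θ(ζ−1) = B(ζ−1)` for all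
  `ζ^{pⁿ} = 1`» ⟹ «`∃ m q : p^m · (ι(A)·θ − ι(B)) = ι(ω_n · q)` in `ℚ_p⟦T⟧`» (the shape of `IsCongrModOmega` and of the (ERL_fin)
  clause of CORE_fin; `p^m` clears the denominators of `θ`, `memIwasawaRat_of_forall_norm_coeff_le`); and the converse
  `forall_eval_of_C_pow_mul_sub_eq_omega_mul`.
* §2 (`p = 2`) **`exists_even_char_apply_cyclotomicGenerator_eq`**: every `ζ ∈ ℂ₂` with `ζ^{2ⁿ} = 1` is `χ(γ)`, `γ = 5`, for an
  EVEN Dirichlet character `χ` modulo `2^{n+2}` of `2`-power order (a character of `G_n = Gal(ℚ_n/ℚ) ≅ (ℤ/2^{n+2})^×/{±1}`):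
  powers of one primitive such character (`exists_isPrimitive_even_orderOf_eq_prime_pow`, `orderOf_apply_cyclotomicGenerator`).
* §3 (any `p`) `tsum_coeff_pairingSum_mul_pow_eq_sum`: the value of Sprung's `P_{n,x}(z) = ∑_{j<pⁿ} z(gʲx)(1+T)ʲ` at `T = ζ − 1` is
  `∑_{j<pⁿ} z(gʲ x) ζʲ` — the character `γʲ ↦ ζʲ` of `G_n` applied to Kurihara's group-ring element (left side of (ERL_χ)).

References: [Sprung2012] Def. 3.1; [Kobayashi2003] (8.23); [Washington1997] §7.1 Prop. 7.2, §7.2; [Pollack2003] Prop. 6.9 (proof), Prop. 6.18 (proof);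
[MazurTateTeitelbaum1986Invent] §I.12–I.13; [Lang1990] Ch. 5 §2.
-/

set_option autoImplicit false
-- the Theorems namespace of this sub repeats the summit name by design (D-0017 nested layout)
set_option linter.dupNamespace false

noncomputable section

open scoped Classical MatrixGroups ModularForm NumberField

open CongruenceSubgroup WeierstrassCurve Field IsDedekindDomain NumberField Polynomial
  Literature.NumberTheory.GaloisRepresentations
  Literature.NumberTheory.EllipticCurves Literature.NumberTheory.EllipticCurves.ModularForms
  Literature.NumberTheory.EllipticCurves.Module Literature.NumberTheory.EllipticCurves.Rank1Residual
  Literature.NumberTheory.EllipticCurves.Kobayashi2003 Literature.NumberTheory.EllipticCurves.Kato2004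
  Literature.NumberTheory.EllipticCurves.Kato2004.EulerSystemValues Literature.NumberTheory.EllipticCurves.GreenbergSelmer
  Literature.NumberTheory.EllipticCurves.Sprung2012 Literature.NumberTheory.EllipticCurves.Sprung2017
  ZpExtension Summit.BirchSwinnertonDyer.Rank1Residual.Supersingular

namespace Summit.BirchSwinnertonDyer.BirchSwinnertonDyer.Theorems.SignedKatoOffTwo.CoreChi

/-! ## §1 Values at the `ζ − 1`, `ζ^{pⁿ} = 1`, versus congruences modulo `ω_n` in `Λ = ℤ_p⟦T⟧` (any prime `p`) -/

section AnyPrime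

variable {p : ℕ} [hp : Fact p.Prime]

/-- **`(ω_n · q)(z) = 0` whenever `(1 + z)^{pⁿ} = 1`, `|z| < 1`**: evaluation on the open unit disc of `ℂ_p` is multiplicative
(`tsum_map_coeff_mul_mul_pow`) and `ω_n(z) = (1+z)^{pⁿ} − 1 = 0`. [cite: Washington1997, §7.2] -/
theorem hasSum_eval_toIwasawa_cyclotomicOmega_mul (n : ℕ) (q : IwasawaAlgebra p) {z : ℂ_[p]}
    (hz : ‖z‖ < 1) (hzn : (1 + z) ^ p ^ n = 1) :
    HasSum (fun k ↦ ((algebraMap ℚ_[p] ℂ_[p]).comp (algebraMap ℤ_[p] ℚ_[p]))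
        (PowerSeries.coeff k (toIwasawa p (cyclotomicOmega p n) * q)) * z ^ k) 0 := by
  set ιZ : ℤ_[p] →+* ℂ_[p] := (algebraMap ℚ_[p] ℂ_[p]).comp (algebraMap ℤ_[p] ℚ_[p]) with hιZ
  have hbd : ∀ (A : PowerSeries ℤ_[p]) (k : ℕ), ‖ιZ (PowerSeries.coeff k A)‖ ≤ 1 :=
    norm_algebraMap_coeff_le_one
  have hs : Summable fun k ↦ ιZ (PowerSeries.coeff k (toIwasawa p (cyclotomicOmega p n) * q)) * z ^ k :=
    summable_map_coeff_mul_pow ιZ (hbd _) hz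
  have h1 := hs.hasSum
  rw [tsum_map_coeff_mul_mul_pow ιZ (hbd _) (hbd _) hz, toIwasawa_apply,
    (hasSum_map_coeff_coe_mul_pow ιZ _ z).tsum_eq, Polynomial.eval₂_map] at h1
  have h0 : (cyclotomicOmega p n).eval₂ (ιZ.comp (Int.castRingHom ℤ_[p])) z = 0 := by
    rw [cyclotomicOmega, eval₂_sub, eval₂_pow, eval₂_add, eval₂_X, eval₂_one, add_comm z 1, hzn, sub_self]
  rwa [h0, zero_mul] at h1

/-- **Evaluation reads the Weierstrass remainder**: if `H = ω_n · q + r` in `Λ` (`r` a polynomial), then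
`H(z) = r(z)` for every `|z| < 1` with `(1+z)^{pⁿ} = 1`. [cite: Washington1997, §7.1 Prop. 7.2] -/
theorem tsum_eval_eq_eval₂_of_eq_omega_mul_add (n : ℕ) {H q : IwasawaAlgebra p} {r : ℤ_[p][X]}
    (hH : H = toIwasawa p (cyclotomicOmega p n) * q + (r : PowerSeries ℤ_[p])) {z : ℂ_[p]}
    (hz : ‖z‖ < 1) (hzn : (1 + z) ^ p ^ n = 1) :
    ∑' k, ((algebraMap ℚ_[p] ℂ_[p]).comp (algebraMap ℤ_[p] ℚ_[p])) (PowerSeries.coeff k H) * z ^ k =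
      r.eval₂ ((algebraMap ℚ_[p] ℂ_[p]).comp (algebraMap ℤ_[p] ℚ_[p])) z := by
  set ιZ : ℤ_[p] →+* ℂ_[p] := (algebraMap ℚ_[p] ℂ_[p]).comp (algebraMap ℤ_[p] ℚ_[p]) with hιZ
  have h := (hasSum_eval_toIwasawa_cyclotomicOmega_mul n q hz hzn).add (hasSum_map_coeff_coe_mul_pow ιZ r z)
  rw [zero_add] at h
  have h' : HasSum (fun k ↦ ιZ (PowerSeries.coeff k H) * z ^ k) (r.eval₂ ιZ z) := by
    refine h.congr_fun fun k ↦ ?_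
    rw [hH, map_add, map_add, add_mul]
  exact h'.tsum_eq

/-- **Vanishing at every `ζ − 1`, `ζ^{pⁿ} = 1`, forces divisibility by `ω_n` in `Λ = ℤ_p⟦T⟧`.** If `H ∈ Λ` satisfies
`H(ζ − 1) = ∑_k ι(H_k)(ζ−1)^k = 0` in `ℂ_p` for every `ζ ∈ ℂ_p` with `ζ^{pⁿ} = 1`, then `ω_n ∣ H`. Proof: Weierstrass division
by the distinguished polynomial `ω_n` (Mathlib `PowerSeries.eq_mul_weierstrassDiv_add_weierstrassMod`; `ω_n ≡ T^{pⁿ} mod p`,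
`LocalTwo.order_map_mk_toIwasawa_cyclotomicOmega`) writes `H = ω_n q + r` with `deg r < pⁿ`; `r(ζ − 1) = H(ζ − 1) = 0` at the `pⁿ`
DISTINCT points `ζ − 1` (a primitive `pⁿ`-th root of unity exists in `ℂ_p`), so `r = 0`. This is the converse of the tree's
`IsCongrModOmega.eval₂_eq`. [cite: Washington1997, §7.1 Prop. 7.2] -/
theorem toIwasawa_cyclotomicOmega_dvd_of_forall_eval_eq_zero (n : ℕ) {H : IwasawaAlgebra p}
    (h : ∀ ζ : ℂ_[p], ζ ^ p ^ n = 1 →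
      ∑' k, ((algebraMap ℚ_[p] ℂ_[p]).comp (algebraMap ℤ_[p] ℚ_[p])) (PowerSeries.coeff k H) * (ζ - 1) ^ k = 0) :
    toIwasawa p (cyclotomicOmega p n) ∣ H := by
  set ιZ : ℤ_[p] →+* ℂ_[p] := (algebraMap ℚ_[p] ℂ_[p]).comp (algebraMap ℤ_[p] ℚ_[p]) with hιZ
  set ω : IwasawaAlgebra p := toIwasawa p (cyclotomicOmega p n) with hω
  have hωne : ω.map (IsLocalRing.residue ℤ_[p]) ≠ 0 := LocalTwo.map_residue_toIwasawa_cyclotomicOmega_ne_zero n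
  have hord : (ω.map (IsLocalRing.residue ℤ_[p])).order.toNat = p ^ n := by
    have h1 := LocalTwo.order_map_mk_toIwasawa_cyclotomicOmega (p := p) n
    change (PowerSeries.map (Ideal.Quotient.mk (IsLocalRing.maximalIdeal ℤ_[p])) ω).order.toNat = p ^ n
    rw [h1]
    rfl
  set q : IwasawaAlgebra p := H /ʷ ω with hq
  set r : ℤ_[p][X] := H %ʷ ω with hr
  have hdiv : H = ω * q + (r : PowerSeries ℤ_[p]) := PowerSeries.eq_mul_weierstrassDiv_add_weierstrassMod H hωne
  have hdeg : r.degree < ((p ^ n : ℕ) : WithBot ℕ) := by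
    have h1 := PowerSeries.degree_weierstrassMod_lt H ω
    rwa [hord] at h1
  -- `r` vanishes at every `ζ - 1`
  have hroot : ∀ ζ : ℂ_[p], ζ ^ p ^ n = 1 → (r.map ιZ).eval (ζ - 1) = 0 := by
    intro ζ hζ
    have hz : ‖ζ - 1‖ < 1 := norm_sub_one_lt_one_of_pow_prime_pow_eq_one hζ
    have hzn : (1 + (ζ - 1)) ^ p ^ n = 1 := by rwa [add_sub_cancel]
    rw [Polynomial.eval_map, ← tsum_eval_eq_eval₂_of_eq_omega_mul_add n hdiv hz hzn]
    exact h ζ hζ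
  -- a primitive `pⁿ`-th root of unity in `ℂ_p`
  haveI : NeZero (p ^ n) := ⟨pow_ne_zero _ hp.out.ne_zero⟩
  obtain ⟨ζ₀, hζ₀⟩ := HasEnoughRootsOfUnity.prim (M := ℂ_[p]) (n := p ^ n)
  have hinjf : Function.Injective fun i : Fin (p ^ n) ↦ ζ₀ ^ (i : ℕ) - 1 := by
    intro i j hij
    exact Fin.ext (hζ₀.pow_inj i.2 j.2 (sub_left_injective hij))
  have hev : ∀ i : Fin (p ^ n), (r.map ιZ).eval ((fun i : Fin (p ^ n) ↦ ζ₀ ^ (i : ℕ) - 1) i) = 0 := fun i ↦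
    hroot _ (by rw [← pow_mul, mul_comm, pow_mul, hζ₀.pow_eq_one, one_pow])
  have hinjZ : Function.Injective (algebraMap ℤ_[p] ℚ_[p]) := Subtype.val_injective
  have hinj : Function.Injective ιZ := (algebraMap ℚ_[p] ℂ_[p]).injective.comp hinjZ
  have hr0 : r = 0 := by
    by_contra hrne
    have hlt : (r.map ιZ).natDegree < Fintype.card (Fin (p ^ n)) := by
      rw [Fintype.card_fin]
      exact Polynomial.natDegree_map_le.trans_lt ((Polynomial.natDegree_lt_iff_degree_lt hrne).mpr hdeg)
    have h0 := Polynomial.eq_zero_of_natDegree_lt_card_of_eval_eq_zero (r.map ιZ) hinjf hev hlt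
    exact hrne ((Polynomial.map_eq_zero_iff hinj).mp h0)
  refine ⟨q, ?_⟩
  rw [hdiv, hr0, Polynomial.coe_zero, add_zero]

/-- The coefficients of a polynomial over `ℚ_p`, viewed as a power series, are bounded (finitely many are non-zero), so the
power series lies in `Λ ⊗ ℚ_p`: some `p^m θ` has coefficients in `ℤ_p`. [cite: MazurTateTeitelbaum1986Invent, §I.12] -/
theorem memIwasawaRat_coe_map (θ : ℚ[X]) :
    MemIwasawaRat p ((θ.map (algebraMap ℚ ℚ_[p]) : ℚ_[p][X]) : PowerSeries ℚ_[p]) := by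
  refine memIwasawaRat_of_forall_norm_coeff_le
    (C := ∑ j ∈ (θ.map (algebraMap ℚ ℚ_[p])).support, ‖(θ.map (algebraMap ℚ ℚ_[p])).coeff j‖) fun k ↦ ?_
  rw [Polynomial.coeff_coe]
  by_cases hk : k ∈ (θ.map (algebraMap ℚ ℚ_[p])).support
  · exact Finset.single_le_sum (f := fun j ↦ ‖(θ.map (algebraMap ℚ ℚ_[p])).coeff j‖) (fun j _ ↦ norm_nonneg _) hk
  · rw [Polynomial.notMem_support_iff.mp hk, norm_zero]
    exact Finset.sum_nonneg fun j _ ↦ norm_nonneg _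

/-- The coefficients of a polynomial over `ℚ_p`, pushed to `ℂ_p`, are bounded. [folklore] -/
theorem exists_norm_coeff_coe_map_le (θ : ℚ[X]) :
    ∃ C : ℝ, ∀ k : ℕ, ‖algebraMap ℚ_[p] ℂ_[p]
      (PowerSeries.coeff k ((θ.map (algebraMap ℚ ℚ_[p]) : ℚ_[p][X]) : PowerSeries ℚ_[p]))‖ ≤ C := by
  obtain ⟨C, hC⟩ := MemIwasawaRat.exists_norm_coeff_le (memIwasawaRat_coe_map (p := p) θ)
  exact ⟨C, fun k ↦ by rw [norm_algebraMap']; exact hC k⟩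

/-- **Character values ⟹ congruence modulo `ω_n` (the (ERL_fin) / `IsCongrModOmega` shape).** For `θ ∈ ℚ[T]` and `A, B ∈ Λ`:
if `A(ζ − 1) · θ(ζ − 1) = B(ζ − 1)` in `ℂ_p` for every `ζ` with `ζ^{pⁿ} = 1` (`F(z) = ∑_k ι(F_k) z^k` for `F ∈ Λ`), then
`p^m · (ι(A)·θ − ι(B)) = ι(ω_n · q)` in `ℚ_p⟦T⟧` for some `m ≥ 0`, `q ∈ Λ`. Proof: `p^m θ = ι(Θ)` for some `Θ ∈ Λ`
(bounded denominators); `H := A Θ − p^m B ∈ Λ` vanishes at every `ζ − 1`; `ω_n ∣ H`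
(`toIwasawa_cyclotomicOmega_dvd_of_forall_eval_eq_zero`). [cite: Washington1997, §7.1 Prop. 7.2] [cite: Pollack2003, Prop. 6.18 (proof)] -/
theorem exists_C_pow_mul_sub_eq_omega_mul_of_forall_eval (n : ℕ) (θ : ℚ[X]) (A B : IwasawaAlgebra p)
    (h : ∀ ζ : ℂ_[p], ζ ^ p ^ n = 1 →
      (∑' k, ((algebraMap ℚ_[p] ℂ_[p]).comp (algebraMap ℤ_[p] ℚ_[p])) (PowerSeries.coeff k A) * (ζ - 1) ^ k) *
          θ.eval₂ (algebraMap ℚ ℂ_[p]) (ζ - 1) =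
        ∑' k, ((algebraMap ℚ_[p] ℂ_[p]).comp (algebraMap ℤ_[p] ℚ_[p])) (PowerSeries.coeff k B) * (ζ - 1) ^ k) :
    ∃ (m : ℕ) (q : IwasawaAlgebra p),
      PowerSeries.C ((p : ℚ_[p]) ^ m) *
          (iwasawaToPowerSeries p A * ((θ.map (algebraMap ℚ ℚ_[p]) : ℚ_[p][X]) : PowerSeries ℚ_[p]) -
            iwasawaToPowerSeries p B) =
        iwasawaToPowerSeries p (((cyclotomicOmega p n).map (Int.castRingHom ℤ_[p]) : PowerSeries ℤ_[p]) * q) := by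
  set ι : ℚ_[p] →+* ℂ_[p] := algebraMap ℚ_[p] ℂ_[p] with hι
  set ιZ : ℤ_[p] →+* ℂ_[p] := (algebraMap ℚ_[p] ℂ_[p]).comp (algebraMap ℤ_[p] ℚ_[p]) with hιZ
  set θ' : PowerSeries ℚ_[p] := ((θ.map (algebraMap ℚ ℚ_[p]) : ℚ_[p][X]) : PowerSeries ℚ_[p]) with hθ'
  -- Step 1: bounded denominators of `θ`
  obtain ⟨m, Θ, hΘ⟩ := memIwasawaRat_coe_map (p := p) θ
  -- Step 2: the integral element `H = A Θ − p^m B`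
  set H : IwasawaAlgebra p := A * Θ - PowerSeries.C ((p : ℤ_[p]) ^ m) * B with hH
  have hC : iwasawaToPowerSeries p (PowerSeries.C ((p : ℤ_[p]) ^ m)) = PowerSeries.C ((p : ℚ_[p]) ^ m) := by
    rw [iwasawaToPowerSeries, PowerSeries.map_C, map_pow, map_natCast]
  have hιH : iwasawaToPowerSeries p H =
      PowerSeries.C ((p : ℚ_[p]) ^ m) * (iwasawaToPowerSeries p A * θ' - iwasawaToPowerSeries p B) := by
    rw [hH, map_sub, map_mul, map_mul, ← hΘ, hC]
    ring
  -- Step 3: `H` vanishes at every `ζ - 1`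
  have hbd : ∀ (G : PowerSeries ℤ_[p]) (k : ℕ), ‖ιZ (PowerSeries.coeff k G)‖ ≤ 1 := norm_algebraMap_coeff_le_one
  have hcoe : ∀ (G : IwasawaAlgebra p) (k : ℕ),
      ι (PowerSeries.coeff k (iwasawaToPowerSeries p G)) = ιZ (PowerSeries.coeff k G) := by
    intro G k
    simp only [hι, hιZ, RingHom.comp_apply, iwasawaToPowerSeries, PowerSeries.coeff_map]
  have hval : ∀ ζ : ℂ_[p], ζ ^ p ^ n = 1 → ∑' k, ιZ (PowerSeries.coeff k H) * (ζ - 1) ^ k = 0 := by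
    intro ζ hζ
    set z : ℂ_[p] := ζ - 1 with hz'
    have hz : ‖z‖ < 1 := norm_sub_one_lt_one_of_pow_prime_pow_eq_one hζ
    have hθsum : HasSum (fun k ↦ ι (PowerSeries.coeff k θ') * z ^ k) (θ.eval₂ (algebraMap ℚ ℂ_[p]) z) := by
      have h1 := hasSum_map_coeff_coe_mul_pow ι (θ.map (algebraMap ℚ ℚ_[p])) z
      rwa [Polynomial.eval₂_map, RingHom.ext_rat (ι.comp (algebraMap ℚ ℚ_[p])) (algebraMap ℚ ℂ_[p])] at h1
    have hΘsum : HasSum (fun k ↦ ιZ (PowerSeries.coeff k Θ) * z ^ k)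
        (ι ((p : ℚ_[p]) ^ m) * θ.eval₂ (algebraMap ℚ ℂ_[p]) z) := by
      have h1 := hθsum.mul_left (ι ((p : ℚ_[p]) ^ m))
      refine h1.congr_fun fun k ↦ ?_
      rw [← hcoe Θ k, ← hΘ, PowerSeries.coeff_C_mul, map_mul, mul_assoc]
    have hAΘ : ∑' k, ιZ (PowerSeries.coeff k (A * Θ)) * z ^ k =
        (∑' k, ιZ (PowerSeries.coeff k A) * z ^ k) * (ι ((p : ℚ_[p]) ^ m) * θ.eval₂ (algebraMap ℚ ℂ_[p]) z) := by
      rw [tsum_map_coeff_mul_mul_pow ιZ (hbd _) (hbd _) hz, hΘsum.tsum_eq]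
    have hCB : ∑' k, ιZ (PowerSeries.coeff k (PowerSeries.C ((p : ℤ_[p]) ^ m) * B)) * z ^ k =
        ι ((p : ℚ_[p]) ^ m) * ∑' k, ιZ (PowerSeries.coeff k B) * z ^ k := by
      rw [← tsum_mul_left]
      refine tsum_congr fun k ↦ ?_
      rw [PowerSeries.coeff_C_mul, map_mul, map_pow, map_natCast, map_pow, map_natCast, mul_assoc]
    have hsA : Summable fun k ↦ ιZ (PowerSeries.coeff k (A * Θ)) * z ^ k :=
      summable_map_coeff_mul_pow ιZ (hbd _) hz
    have hsB : Summable fun k ↦ ιZ (PowerSeries.coeff k (PowerSeries.C ((p : ℤ_[p]) ^ m) * B)) * z ^ k :=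
      summable_map_coeff_mul_pow ιZ (hbd _) hz
    calc ∑' k, ιZ (PowerSeries.coeff k H) * z ^ k
        = ∑' k, (ιZ (PowerSeries.coeff k (A * Θ)) * z ^ k -
            ιZ (PowerSeries.coeff k (PowerSeries.C ((p : ℤ_[p]) ^ m) * B)) * z ^ k) := by
          refine tsum_congr fun k ↦ ?_
          rw [hH, map_sub, map_sub, sub_mul]
      _ = (∑' k, ιZ (PowerSeries.coeff k (A * Θ)) * z ^ k) -
            ∑' k, ιZ (PowerSeries.coeff k (PowerSeries.C ((p : ℤ_[p]) ^ m) * B)) * z ^ k := hsA.tsum_sub hsB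
      _ = ι ((p : ℚ_[p]) ^ m) * ((∑' k, ιZ (PowerSeries.coeff k A) * z ^ k) * θ.eval₂ (algebraMap ℚ ℂ_[p]) z -
            ∑' k, ιZ (PowerSeries.coeff k B) * z ^ k) := by
          rw [hAΘ, hCB]
          ring
      _ = 0 := by rw [hz', h ζ hζ, sub_self, mul_zero]
  -- Step 4: `ω_n ∣ H`
  obtain ⟨q, hq⟩ := toIwasawa_cyclotomicOmega_dvd_of_forall_eval_eq_zero n hval
  refine ⟨m, q, ?_⟩
  rw [← hιH, hq, toIwasawa_apply]

/-- **Congruence modulo `ω_n` ⟹ character values** (the direction of the tree's `IsCongrModOmega.eval₂_eq`, in the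
two-`Λ`-element shape used by (ERL_fin)): if `p^m · (ι(A)·θ − ι(B)) = ι(ω_n · q)` in `ℚ_p⟦T⟧`, then
`A(ζ − 1)·θ(ζ − 1) = B(ζ − 1)` in `ℂ_p` for every `ζ` with `ζ^{pⁿ} = 1` (evaluate both sides at `ζ − 1`: the right side is
`ω_n(ζ−1) q(ζ−1) = 0`, and `p^m ≠ 0`). [cite: Pollack2003, Prop. 6.18 (proof)] [cite: Washington1997, §7.2] -/
theorem forall_eval_of_C_pow_mul_sub_eq_omega_mul (n : ℕ) (θ : ℚ[X]) (A B : IwasawaAlgebra p) {m : ℕ}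
    {q : IwasawaAlgebra p}
    (hmq : PowerSeries.C ((p : ℚ_[p]) ^ m) *
          (iwasawaToPowerSeries p A * ((θ.map (algebraMap ℚ ℚ_[p]) : ℚ_[p][X]) : PowerSeries ℚ_[p]) -
            iwasawaToPowerSeries p B) =
        iwasawaToPowerSeries p (((cyclotomicOmega p n).map (Int.castRingHom ℤ_[p]) : PowerSeries ℤ_[p]) * q)) :
    ∀ ζ : ℂ_[p], ζ ^ p ^ n = 1 →
      (∑' k, ((algebraMap ℚ_[p] ℂ_[p]).comp (algebraMap ℤ_[p] ℚ_[p])) (PowerSeries.coeff k A) * (ζ - 1) ^ k) *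
          θ.eval₂ (algebraMap ℚ ℂ_[p]) (ζ - 1) =
        ∑' k, ((algebraMap ℚ_[p] ℂ_[p]).comp (algebraMap ℤ_[p] ℚ_[p])) (PowerSeries.coeff k B) * (ζ - 1) ^ k := by
  intro ζ hζ
  set ι : ℚ_[p] →+* ℂ_[p] := algebraMap ℚ_[p] ℂ_[p] with hι
  set ιZ : ℤ_[p] →+* ℂ_[p] := (algebraMap ℚ_[p] ℂ_[p]).comp (algebraMap ℤ_[p] ℚ_[p]) with hιZ
  set θ' : PowerSeries ℚ_[p] := ((θ.map (algebraMap ℚ ℚ_[p]) : ℚ_[p][X]) : PowerSeries ℚ_[p]) with hθ'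
  set z : ℂ_[p] := ζ - 1 with hz'
  have hz : ‖z‖ < 1 := norm_sub_one_lt_one_of_pow_prime_pow_eq_one hζ
  have hzn : (1 + z) ^ p ^ n = 1 := by rw [hz', add_sub_cancel]; exact hζ
  have hbd : ∀ (G : PowerSeries ℤ_[p]) (k : ℕ), ‖ιZ (PowerSeries.coeff k G)‖ ≤ 1 := norm_algebraMap_coeff_le_one
  have hcoe : ∀ (G : IwasawaAlgebra p) (k : ℕ),
      ι (PowerSeries.coeff k (iwasawaToPowerSeries p G)) = ιZ (PowerSeries.coeff k G) := by
    intro G k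
    simp only [hι, hιZ, RingHom.comp_apply, iwasawaToPowerSeries, PowerSeries.coeff_map]
  -- evaluation of `ι(G)`, `G ∈ Λ`, at `z` is `G(z)`
  have hΛ : ∀ G : IwasawaAlgebra p, HasSum (fun k ↦ ι (PowerSeries.coeff k (iwasawaToPowerSeries p G)) * z ^ k)
      (∑' k, ιZ (PowerSeries.coeff k G) * z ^ k) := by
    intro G
    have h1 := (summable_map_coeff_mul_pow ιZ (hbd G) hz).hasSum
    exact h1.congr_fun fun k ↦ by rw [hcoe]
  -- the right-hand side evaluates to `0`
  have hR : HasSum (fun k ↦ ι (PowerSeries.coeff k (iwasawaToPowerSeries p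
      (((cyclotomicOmega p n).map (Int.castRingHom ℤ_[p]) : PowerSeries ℤ_[p]) * q))) * z ^ k) 0 := by
    have h1 := hasSum_eval_toIwasawa_cyclotomicOmega_mul n q hz hzn
    rw [toIwasawa_apply] at h1
    exact h1.congr_fun fun k ↦ by rw [hcoe]
  -- the left-hand side evaluates to `p^m (A(z) θ(z) − B(z))`
  have hθsum : HasSum (fun k ↦ ι (PowerSeries.coeff k θ') * z ^ k) (θ.eval₂ (algebraMap ℚ ℂ_[p]) z) := by
    have h1 := hasSum_map_coeff_coe_mul_pow ι (θ.map (algebraMap ℚ ℚ_[p])) z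
    rwa [Polynomial.eval₂_map, RingHom.ext_rat (ι.comp (algebraMap ℚ ℚ_[p])) (algebraMap ℚ ℂ_[p])] at h1
  have hAθ : HasSum (fun k ↦ ι (PowerSeries.coeff k (iwasawaToPowerSeries p A * θ')) * z ^ k)
      ((∑' k, ιZ (PowerSeries.coeff k A) * z ^ k) * θ.eval₂ (algebraMap ℚ ℂ_[p]) z) :=
    MemIwasawaRat.hasSum_eval_mul (memIwasawaRat_iwasawaToPowerSeries p A) (memIwasawaRat_coe_map θ) hz
      (hΛ A) hθsum
  have hdiff : HasSum (fun k ↦ ι (PowerSeries.coeff k (iwasawaToPowerSeries p A * θ' - iwasawaToPowerSeries p B)) * z ^ k)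
      ((∑' k, ιZ (PowerSeries.coeff k A) * z ^ k) * θ.eval₂ (algebraMap ℚ ℂ_[p]) z -
        ∑' k, ιZ (PowerSeries.coeff k B) * z ^ k) := by
    refine (hAθ.sub (hΛ B)).congr_fun fun k ↦ ?_
    rw [map_sub, map_sub, sub_mul]
  have hL := hasSum_eval_C_mul ((p : ℚ_[p]) ^ m) hdiff
  -- compare
  rw [hmq] at hL
  have key := hL.unique hR
  have hpm : ι ((p : ℚ_[p]) ^ m) ≠ 0 := by
    rw [map_pow, map_natCast]
    exact pow_ne_zero _ (Nat.cast_ne_zero.mpr hp.out.ne_zero)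
  have h0 := (mul_eq_zero.mp key).resolve_left hpm
  rwa [sub_eq_zero] at h0

end AnyPrime

/-! ## §2 Every `2ⁿ`-th root of unity in `ℂ₂` is `χ(γ)` for a character `χ` of `G_n` (`p = 2`, `γ = 5`, level `2^{n+2}`) -/

section Two

/-- **The characters of `G_n = Gal(ℚ_n/ℚ)` exhaust `μ_{2ⁿ}` through `χ ↦ χ(γ)`.** For every `ζ ∈ ℂ₂` with `ζ^{2ⁿ} = 1` there is
an EVEN Dirichlet character `χ` modulo `2^{n + e₀} = 2^{n+2}` of `2`-power order (i.e. a character of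
`(ℤ/2^{n+2})^× / {±1} ≅ Γ/Γ^{2ⁿ} = G_n`) with `χ(γ) = ζ`, `γ = cyclotomicGenerator 2 = 5`: for `n ≥ 1` take a primitive such
character `ψ` (`exists_isPrimitive_even_orderOf_eq_prime_pow`; `ψ(γ)` has order exactly `2ⁿ`, `orderOf_apply_cyclotomicGenerator`) and
`χ = ψ^i` with `ψ(γ)^i = ζ`; for `n = 0`, `ζ = 1` and `χ = 1`. [cite: Washington1997, §7.2] [cite: MazurTateTeitelbaum1986Invent, §I.13] -/
theorem exists_even_char_apply_cyclotomicGenerator_eq (n : ℕ) {ζ : ℂ_[2]} (hζ : ζ ^ 2 ^ n = 1) :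
    ∃ χ : DirichletCharacter ℂ_[2] (2 ^ (n + cyclotomicExponent 2)),
      χ.Even ∧ (∃ j : ℕ, orderOf χ = 2 ^ j) ∧
        χ (cyclotomicGenerator 2 : ZMod (2 ^ (n + cyclotomicExponent 2))) = ζ := by
  classical
  have hce : cyclotomicExponent 2 = 2 := by rw [cyclotomicExponent, if_pos rfl]
  obtain ⟨u, hu⟩ := isUnit_cyclotomicGenerator_cast 2 (n + cyclotomicExponent 2)
  rcases Nat.eq_zero_or_pos n with rfl | hn
  · -- `n = 0`: `ζ = 1`, `χ = 1`
    rw [pow_zero, pow_one] at hζ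
    refine ⟨1, ?_, ⟨0, by rw [pow_zero, orderOf_one]⟩, ?_⟩
    · show (1 : DirichletCharacter ℂ_[2] (2 ^ (0 + cyclotomicExponent 2))) (-1) = 1
      rw [← Units.coe_neg_one, MulChar.one_apply_coe]
    · rw [← hu, MulChar.one_apply_coe, hζ]
  · -- `n ≥ 1`: powers of a primitive even character of conductor `2^{n+2}`
    have key : ∀ m : ℕ, m = (n - 1) + 3 → ∃ ψ : DirichletCharacter ℂ_[2] (2 ^ m),
        ψ.IsPrimitive ∧ ψ.Even ∧ ∃ j : ℕ, orderOf ψ = 2 ^ j := by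
      rintro m rfl
      haveI : NeZero (Nat.totient (2 ^ ((n - 1) + 3))) := ⟨(Nat.totient_pos.mpr (pow_pos two_pos _)).ne'⟩
      exact exists_isPrimitive_even_orderOf_eq_prime_pow ℂ_[2] (n - 1)
    obtain ⟨ψ, hψ, hev, hord⟩ := key (n + cyclotomicExponent 2) (by rw [hce]; omega)
    have hordγ : orderOf (ψ (cyclotomicGenerator 2 : ZMod (2 ^ (n + cyclotomicExponent 2)))) = 2 ^ n := by
      have h1 := orderOf_apply_cyclotomicGenerator (p := 2) (m := n + cyclotomicExponent 2) (by omega) ψ hψ hev hord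
      rwa [Nat.add_sub_cancel] at h1
    have hprim : IsPrimitiveRoot (ψ (cyclotomicGenerator 2 : ZMod (2 ^ (n + cyclotomicExponent 2)))) (2 ^ n) :=
      hordγ ▸ IsPrimitiveRoot.orderOf _
    haveI : NeZero (2 ^ n) := ⟨pow_ne_zero _ two_ne_zero⟩
    obtain ⟨i, -, hi⟩ := hprim.eq_pow_of_pow_eq_one hζ
    obtain ⟨j, hj⟩ := hord
    refine ⟨ψ ^ i, ?_, ?_, ?_⟩
    · show (ψ ^ i) (-1) = 1
      rw [← Units.coe_neg_one, MulChar.pow_apply_coe, Units.coe_neg_one, hev, one_pow]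
    · have hdvd : orderOf (ψ ^ i) ∣ 2 ^ j := hj ▸ orderOf_pow_dvd i
      obtain ⟨j', -, hj'⟩ := (Nat.dvd_prime_pow Nat.prime_two).1 hdvd
      exact ⟨j', hj'⟩
    · rw [← hu, MulChar.pow_apply_coe, hu, hi]

end Two

/-! ## §3 The character value of Kurihara's group-ring element `P_{n,x}(z)` (any prime `p`) -/

section PairingSumValue

universe u

variable {p : ℕ} [hp : Fact p.Prime] {K : Type u} [Field K] {E : Type u} [Field E] [Algebra K E]
  (W : WeierstrassCurve K)

/-- **`P_{n,x}(z)(ζ − 1) = ∑_{j<pⁿ} z(gʲ x) ζʲ = χ(P_{n,x}(z))`**: the value at `T = ζ − 1` of Sprung's representative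
`P_{n,x}(z) = ∑_{j<pⁿ} z(gʲ•x)(1+T)ʲ ∈ Λ` (`Sprung2012.pairingSum`, Def. 3.1 = Kobayashi (8.23) `∑_σ (x^σ, z)_n σ`) is the character
`σ = γʲ ↦ ζʲ` of `G_n` applied to the group-ring element — the left-hand side of (ERL_χ). (`P_{n,x}(z)` is a polynomial in `1+T`,
so its evaluation series is a finite sum.) [cite: Sprung2012, Def. 3.1 (p. 1489)] [cite: Kobayashi2003, (8.23)] -/
theorem tsum_coeff_pairingSum_mul_pow_eq_sum (A : AddSubgroup (localPoints W E)) (g : Field.absoluteGaloisGroup E) (n : ℕ)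
    (x : localPoints W E) (z : A →+ ℤ_[p]) (ζ : ℂ_[p]) :
    ∑' k, ((algebraMap ℚ_[p] ℂ_[p]).comp (algebraMap ℤ_[p] ℚ_[p])) (PowerSeries.coeff k (pairingSum W A g n x z)) * (ζ - 1) ^ k =
      ∑ j ∈ Finset.range (p ^ n),
        ((algebraMap ℚ_[p] ℂ_[p]).comp (algebraMap ℤ_[p] ℚ_[p])) (evalOn W A z (g ^ j • x)) * ζ ^ j := by
  set ιZ : ℤ_[p] →+* ℂ_[p] := (algebraMap ℚ_[p] ℂ_[p]).comp (algebraMap ℤ_[p] ℚ_[p]) with hιZ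
  set P : ℤ_[p][X] := ∑ j ∈ Finset.range (p ^ n), Polynomial.C (evalOn W A z (g ^ j • x)) * (Polynomial.X + 1) ^ j with hP
  have hcoe : pairingSum W A g n x z = (P : PowerSeries ℤ_[p]) := by
    rw [pairingSum_def, hP, ← Polynomial.coeToPowerSeries.ringHom_apply, map_sum]
    refine Finset.sum_congr rfl fun j _ ↦ ?_
    rw [map_mul, map_pow, map_add, map_one, Polynomial.coeToPowerSeries.ringHom_apply,
      Polynomial.coeToPowerSeries.ringHom_apply, Polynomial.coe_C, Polynomial.coe_X, add_comm]
  rw [hcoe, (hasSum_map_coeff_coe_mul_pow ιZ P (ζ - 1)).tsum_eq, hP, eval₂_finsetSum]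
  refine Finset.sum_congr rfl fun j _ ↦ ?_
  rw [eval₂_mul, eval₂_C, eval₂_pow, eval₂_add, eval₂_X, eval₂_one, sub_add_cancel]

end PairingSumValue

end Summit.BirchSwinnertonDyer.BirchSwinnertonDyer.Theorems.SignedKatoOffTwo.CoreChi

end
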